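import Mathlib

/-!
# Solo-blind: the block (Schur / Banachiewicz) skeleton of L3

Paper `steady-zeroth-law.md`, §24.24(1), §24.32 and §24.33: the exact linearisation `𝓛ₙ` of the
steady Navier–Stokes map at the order-`K` approximate state is written in blocks on
`H_⊥ ⊕ H_∥` (leafwise mean-free data ⊕ leaf functions and neutral-mode amplitudes),

  `T x + B y = g`,   `C x + J y = h`,

and L3 = (i) an `n`-uniform inverse bound for the transport block `T` ((APB_𝔅), §24.30(4)),
(ii) an inverse bound for a REFERENCE reduced operator `J₀` (outer shooting problem of Thm 24.23
⊕ the dead-lobe well block at mid-gap, §24.27(B)(3)), (iii) closeness of the Schur complement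
`S = J − C T⁻¹ B` to `J₀`.  This file is the normed-space algebra that turns (i)–(iii) into the
a-priori bound `‖x‖ + ‖y‖ ≤ C (‖g‖ + ‖h‖)` consumed by the contraction step
(`SoloBlindNewtonClose`), with the constants explicit:

* `inverse_bound_of_close` — (ii)+(iii): `‖y‖ ≤ b‖J₀ y‖`, `‖S y − J₀ y‖ ≤ q‖y‖`, `q b < 1` give
  `‖y‖ ≤ (b / (1 − q b)) ‖S y‖` (no linearity needed).
* `schur_apriori` — elimination of `x`: with a left inverse `Tinv` of `T` of bound `a`,
  `‖B‖ ≤ β`, `‖C‖ ≤ γ` and an inverse bound `s` for the Schur complement, every solution of the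
  block system obeys `‖y‖ ≤ s (‖h‖ + γ a ‖g‖)` and `‖x‖ ≤ a (‖g‖ + β ‖y‖)`.
* `schur_apriori_total`, `block_injective` — the assembled bound and injectivity of the block map.
* `inverse_bound_of_comp`, `inverse_bound_of_conj` — inverse bounds through a factorisation
  `S = F ∘ G` and a conjugation `S = M S̃ M⁻¹` (§24.35: the bounded real weight that symmetrises
  the well operator on its zero-energy curve).
* `two_sector_bound` — (ii) for `J₀ = J_out ⊕ J_well` coupled only by tunnelling of size `τ`
  (`s₁ s₂ τ² < 1`): the sector bounds survive.
* `midgap_closeness_eventually` — the bookkeeping of §24.33: a well inverse bound `b = C n^p`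
  (`p = 1/3`) against a closeness `q = Q n^{-m}` with `m > p` (reference order `K ≥ 9`, `m = 4/9`)
  gives `q b ≤ 1/2`, hence `‖y‖ ≤ 2 b ‖S y‖`, for all large `n`.

Only a-priori (injectivity) bounds are produced here; surjectivity of `𝓛ₙ` is the Fredholm
alternative on `X^sym_n` (compact resolvent), not part of this file.
-/

namespace Summit.AnomalousDissipation.AnomalousDissipation.Theorems

open Filter Topology

variable {E F : Type*} [NormedAddCommGroup E] [NormedAddCommGroup F]

/-- (ii)+(iii) ⇒ inverse bound for the Schur complement: if the reference operator `J₀` has the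
inverse bound `b` and `S` is `q`-close to it with `q b < 1`, then `S` has the inverse bound
`b / (1 - q b)`.  Plain maps; no linearity is used. -/
theorem inverse_bound_of_close (S J₀ : F → F) {b q : ℝ} (hb : 0 ≤ b)
    (hJ : ∀ y, ‖y‖ ≤ b * ‖J₀ y‖) (hq : ∀ y, ‖S y - J₀ y‖ ≤ q * ‖y‖) (hqb : q * b < 1)
    (y : F) : ‖y‖ ≤ b / (1 - q * b) * ‖S y‖ := by
  have hpos : 0 < 1 - q * b := by linarith
  have h1 : ‖J₀ y‖ ≤ ‖S y‖ + q * ‖y‖ := by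
    have : J₀ y = S y - (S y - J₀ y) := by abel
    calc ‖J₀ y‖ = ‖S y - (S y - J₀ y)‖ := by rw [← this]
      _ ≤ ‖S y‖ + ‖S y - J₀ y‖ := norm_sub_le _ _
      _ ≤ ‖S y‖ + q * ‖y‖ := by linarith [hq y]
  have h2 : ‖y‖ ≤ b * ‖S y‖ + q * b * ‖y‖ := by
    have := hJ y
    nlinarith [norm_nonneg (S y), norm_nonneg y]
  have h3 : (1 - q * b) * ‖y‖ ≤ b * ‖S y‖ := by nlinarith
  rw [div_mul_eq_mul_div, le_div_iff₀ hpos]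
  linarith

section Schur

variable [NormedSpace ℝ E] [NormedSpace ℝ F]

/-- Schur elimination, a-priori form.  `Tinv` is a linear left inverse of the transport block `T`
with bound `a`; `B`, `C` are bounded by `β`, `γ`; the Schur complement
`y ↦ J y - C (Tinv (B y))` has the inverse bound `s`.  Then every solution `(x, y)` of
`T x + B y = g`, `C x + J y = h` satisfies the two a-priori bounds. -/
theorem schur_apriori (T : E → E) (Tinv : E →ₗ[ℝ] E) (B : F → E) (C : E →ₗ[ℝ] F) (J : F → F)
    (hTinv : ∀ x, Tinv (T x) = x) {a β γ s : ℝ} (ha : 0 ≤ a) (hγ : 0 ≤ γ) (hs : 0 ≤ s)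
    (hTa : ∀ g, ‖Tinv g‖ ≤ a * ‖g‖) (hB : ∀ y, ‖B y‖ ≤ β * ‖y‖) (hC : ∀ x, ‖C x‖ ≤ γ * ‖x‖)
    (hS : ∀ y, ‖y‖ ≤ s * ‖J y - C (Tinv (B y))‖)
    {x g : E} {y h : F} (h1 : T x + B y = g) (h2 : C x + J y = h) :
    ‖y‖ ≤ s * (‖h‖ + γ * (a * ‖g‖)) ∧ ‖x‖ ≤ a * (‖g‖ + β * ‖y‖) := by
  have hTx : T x = g - B y := eq_sub_of_add_eq h1
  have hx : x = Tinv g - Tinv (B y) := by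
    have := hTinv x
    rw [hTx, map_sub] at this
    exact this.symm
  have hSchur : J y - C (Tinv (B y)) = h - C (Tinv g) := by
    have h2' : C (Tinv g - Tinv (B y)) + J y = h := by rw [← hx]; exact h2
    rw [map_sub] at h2'
    rw [← h2']; abel
  constructor
  · calc ‖y‖ ≤ s * ‖J y - C (Tinv (B y))‖ := hS y
      _ = s * ‖h - C (Tinv g)‖ := by rw [hSchur]
      _ ≤ s * (‖h‖ + ‖C (Tinv g)‖) := by gcongr; exact norm_sub_le _ _
      _ ≤ s * (‖h‖ + γ * (a * ‖g‖)) := by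
          gcongr
          calc ‖C (Tinv g)‖ ≤ γ * ‖Tinv g‖ := hC _
            _ ≤ γ * (a * ‖g‖) := mul_le_mul_of_nonneg_left (hTa g) hγ
  · calc ‖x‖ = ‖Tinv (g - B y)‖ := by rw [hx, map_sub]
      _ ≤ a * ‖g - B y‖ := hTa _
      _ ≤ a * (‖g‖ + ‖B y‖) := by gcongr; exact norm_sub_le _ _
      _ ≤ a * (‖g‖ + β * ‖y‖) := by gcongr; exact hB y

/-- The assembled a-priori bound of the block system: with `β ≥ 0` the two bounds of
`schur_apriori` combine to `‖x‖ + ‖y‖ ≤ K_g ‖g‖ + K_h ‖h‖` with the explicit constants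
`K_g = a + (1 + a β) s γ a`, `K_h = (1 + a β) s`.  In L3: `a` = the `n`-free transport bound
(APB_𝔅), `s ≲ n^{1/3}` (well block at mid-gap), so `‖𝓛ₙ⁻¹‖ ≲ n^{1/3}` in the intrinsic norms. -/
theorem schur_apriori_total (T : E → E) (Tinv : E →ₗ[ℝ] E) (B : F → E) (C : E →ₗ[ℝ] F)
    (J : F → F) (hTinv : ∀ x, Tinv (T x) = x) {a β γ s : ℝ} (ha : 0 ≤ a) (hβ : 0 ≤ β)
    (hγ : 0 ≤ γ) (hs : 0 ≤ s) (hTa : ∀ g, ‖Tinv g‖ ≤ a * ‖g‖) (hB : ∀ y, ‖B y‖ ≤ β * ‖y‖)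
    (hC : ∀ x, ‖C x‖ ≤ γ * ‖x‖) (hS : ∀ y, ‖y‖ ≤ s * ‖J y - C (Tinv (B y))‖)
    {x g : E} {y h : F} (h1 : T x + B y = g) (h2 : C x + J y = h) :
    ‖x‖ + ‖y‖ ≤ (a + (1 + a * β) * s * γ * a) * ‖g‖ + (1 + a * β) * s * ‖h‖ := by
  obtain ⟨hy, hx⟩ := schur_apriori T Tinv B C J hTinv ha hγ hs hTa hB hC hS h1 h2
  have hab : 0 ≤ a * β := mul_nonneg ha hβ
  have hx' : ‖x‖ ≤ a * ‖g‖ + a * β * (s * (‖h‖ + γ * (a * ‖g‖))) := by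
    calc ‖x‖ ≤ a * (‖g‖ + β * ‖y‖) := hx
      _ = a * ‖g‖ + a * β * ‖y‖ := by ring
      _ ≤ a * ‖g‖ + a * β * (s * (‖h‖ + γ * (a * ‖g‖))) := by gcongr
  have : ‖x‖ + ‖y‖ ≤ a * ‖g‖ + a * β * (s * (‖h‖ + γ * (a * ‖g‖)))
      + s * (‖h‖ + γ * (a * ‖g‖)) := add_le_add hx' hy
  calc ‖x‖ + ‖y‖ ≤ _ := this
    _ = (a + (1 + a * β) * s * γ * a) * ‖g‖ + (1 + a * β) * s * ‖h‖ := by ring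

/-- Injectivity of the block operator from the a-priori bounds: `g = 0`, `h = 0` force
`x = 0`, `y = 0`.  (Surjectivity is the Fredholm alternative on `X^sym_n`, not proved here.) -/
theorem block_injective (T : E → E) (Tinv : E →ₗ[ℝ] E) (B : F → E) (C : E →ₗ[ℝ] F)
    (J : F → F) (hTinv : ∀ x, Tinv (T x) = x) {a β γ s : ℝ} (ha : 0 ≤ a) (hγ : 0 ≤ γ)
    (hs : 0 ≤ s) (hTa : ∀ g, ‖Tinv g‖ ≤ a * ‖g‖) (hB : ∀ y, ‖B y‖ ≤ β * ‖y‖)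
    (hC : ∀ x, ‖C x‖ ≤ γ * ‖x‖) (hS : ∀ y, ‖y‖ ≤ s * ‖J y - C (Tinv (B y))‖)
    {x : E} {y : F} (h1 : T x + B y = 0) (h2 : C x + J y = 0) : x = 0 ∧ y = 0 := by
  obtain ⟨hy, hx⟩ := schur_apriori T Tinv B C J hTinv ha hγ hs hTa hB hC hS h1 h2
  have hy0 : y = 0 := by
    have : ‖y‖ ≤ 0 := by simpa using hy
    exact norm_le_zero_iff.mp this
  subst hy0
  have hx0 : ‖x‖ ≤ 0 := by simpa using hx
  exact ⟨norm_le_zero_iff.mp hx0, rfl⟩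

end Schur


section Conj

variable {F' : Type*} [NormedAddCommGroup F']

/-- Inverse bound of a composition `S = F ∘ G` from inverse bounds of the factors:
`‖z‖ ≤ f‖F z‖`, `‖y‖ ≤ g‖G y‖` give `‖y‖ ≤ g f ‖S y‖`.  Used in §24.35(1)(v) with
`F = I + i h C` (inverse bound `1 + O(h)`) and `G = A + h² R'` (inverse bound `2/d` at mid-gap, from
`inverse_bound_of_close`). -/
theorem inverse_bound_of_comp (F G : F' → F') {f g : ℝ} (hg : 0 ≤ g)
    (hF : ∀ z, ‖z‖ ≤ f * ‖F z‖) (hG : ∀ y, ‖y‖ ≤ g * ‖G y‖) (y : F') :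
    ‖y‖ ≤ g * f * ‖F (G y)‖ := by
  calc ‖y‖ ≤ g * ‖G y‖ := hG y
    _ ≤ g * (f * ‖F (G y)‖) := by gcongr; exact hF (G y)
    _ = g * f * ‖F (G y)‖ := by ring

/-- Inverse bound under conjugation `S = M ∘ S̃ ∘ M⁻¹` (§24.35: `M` = multiplication by the bounded
real weight `e^{φ₁}`): if `‖M z‖ ≤ m₁‖z‖`, `Minv` is a left inverse of `M` with `‖Minv w‖ ≤ m₂‖w‖`,
`M (Minv y) = y`, and `S̃` has the inverse bound `s`, then `S` has the inverse bound `m₁ m₂ s`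
(the factor `e^{2 sup |φ₁|}` of 24.35(0)). -/
theorem inverse_bound_of_conj (S' M Minv : F' → F') {m₁ m₂ s : ℝ} (hm₁ : 0 ≤ m₁) (hs : 0 ≤ s)
    (hM : ∀ z, ‖M z‖ ≤ m₁ * ‖z‖) (hMinv : ∀ w, ‖Minv w‖ ≤ m₂ * ‖w‖)
    (hleft : ∀ z, Minv (M z) = z) (hright : ∀ y, M (Minv y) = y)
    (hS : ∀ z, ‖z‖ ≤ s * ‖S' z‖) (y : F') :
    ‖y‖ ≤ m₁ * m₂ * s * ‖M (S' (Minv y))‖ := by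
  have h1 : ‖y‖ ≤ m₁ * ‖Minv y‖ := by
    calc ‖y‖ = ‖M (Minv y)‖ := by rw [hright]
      _ ≤ m₁ * ‖Minv y‖ := hM _
  have h2 : ‖Minv y‖ ≤ s * ‖S' (Minv y)‖ := hS _
  have h3 : ‖S' (Minv y)‖ ≤ m₂ * ‖M (S' (Minv y))‖ := by
    calc ‖S' (Minv y)‖ = ‖Minv (M (S' (Minv y)))‖ := by rw [hleft]
      _ ≤ m₂ * ‖M (S' (Minv y))‖ := hMinv _
  calc ‖y‖ ≤ m₁ * ‖Minv y‖ := h1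
    _ ≤ m₁ * (s * ‖S' (Minv y)‖) := by gcongr
    _ ≤ m₁ * (s * (m₂ * ‖M (S' (Minv y))‖)) := by gcongr
    _ = m₁ * m₂ * s * ‖M (S' (Minv y))‖ := by ring

end Conj

/-- (ii) for a reference operator that is a direct sum `J_out ⊕ J_well` up to a weak coupling
(tunnelling / corner tails of size `τ`, §24.33(c)): if `u = ‖y_out‖`, `v = ‖y_well‖` obey the
sector bounds `u ≤ s₁ (r₁ + τ v)`, `v ≤ s₂ (r₂ + τ u)` and `s₁ s₂ τ² < 1`, both are bounded by the
data `r₁, r₂` with explicit constants.  Pure real arithmetic. -/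
theorem two_sector_bound {u v s₁ s₂ τ r₁ r₂ : ℝ} (hs₁ : 0 ≤ s₁) (hs₂ : 0 ≤ s₂) (hτ : 0 ≤ τ)
    (h1 : u ≤ s₁ * (r₁ + τ * v)) (h2 : v ≤ s₂ * (r₂ + τ * u)) (hst : s₁ * s₂ * τ ^ 2 < 1) :
    u ≤ (s₁ * r₁ + s₁ * τ * s₂ * r₂) / (1 - s₁ * s₂ * τ ^ 2) ∧
      v ≤ (s₂ * r₂ + s₂ * τ * s₁ * r₁) / (1 - s₁ * s₂ * τ ^ 2) := by
  have hpos : 0 < 1 - s₁ * s₂ * τ ^ 2 := by linarith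
  have h1' : u ≤ s₁ * r₁ + s₁ * τ * (s₂ * (r₂ + τ * u)) := by
    have : s₁ * τ * v ≤ s₁ * τ * (s₂ * (r₂ + τ * u)) :=
      mul_le_mul_of_nonneg_left h2 (mul_nonneg hs₁ hτ)
    linarith
  have h2' : v ≤ s₂ * r₂ + s₂ * τ * (s₁ * (r₁ + τ * v)) := by
    have : s₂ * τ * u ≤ s₂ * τ * (s₁ * (r₁ + τ * v)) :=
      mul_le_mul_of_nonneg_left h1 (mul_nonneg hs₂ hτ)
    linarith
  constructor
  · rw [le_div_iff₀ hpos]; nlinarith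
  · rw [le_div_iff₀ hpos]; nlinarith

/-- The bookkeeping of §24.33: a well inverse bound growing like `C n^p` against a closeness
decaying like `Q n^{-m}` with `m > p` gives `q b ≤ 1/2` for all large `n`.  In the paper
`p = 1/3` (eigenvalue spacing of the dead-lobe well) and `m = 4/9` (residual shift of the well
levels after tuning mid-gap with respect to the order-`K ≥ 9` reference mean flow). -/
theorem midgap_closeness_eventually {C Q p m : ℝ} (hpm : p < m) :
    ∀ᶠ n : ℕ in atTop, (Q * (n : ℝ) ^ (-m)) * (C * (n : ℝ) ^ p) ≤ 1 / 2 := by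
  have h1 : Tendsto (fun x : ℝ => x ^ (-(m - p))) atTop (𝓝 0) :=
    tendsto_rpow_neg_atTop (by linarith)
  have h2 : Tendsto (fun n : ℕ => (C * Q) * ((n : ℝ) ^ (-(m - p)))) atTop
      (𝓝 ((C * Q) * 0)) :=
    (h1.comp tendsto_natCast_atTop_atTop).const_mul (C * Q)
  rw [mul_zero] at h2
  have h3 : ∀ᶠ n : ℕ in atTop, (C * Q) * ((n : ℝ) ^ (-(m - p))) ≤ 1 / 2 :=
    h2.eventually (ge_mem_nhds (by norm_num))
  filter_upwards [h3, eventually_gt_atTop 0] with n hn hn0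
  have hn' : (0 : ℝ) < (n : ℝ) := by exact_mod_cast hn0
  have : (Q * (n : ℝ) ^ (-m)) * (C * (n : ℝ) ^ p) = (C * Q) * (n : ℝ) ^ (-(m - p)) := by
    rw [show -(m - p) = -m + p by ring, Real.rpow_add hn']
    ring
  rw [this]
  exact hn

universe u in
/-- Corollary ((ii)+(iii) of L3 with the rates of §24.33): for all large `n`, ANY pair of maps
`S, J₀` on ANY normed group (the spaces `X^sym_n` vary with `n`, hence the inner quantifier) with
reference inverse bound `C n^p` and closeness `Q n^{-m}`, `m > p`, satisfies
`‖y‖ ≤ 2 C n^p ‖S y‖` — the `n^{1/3}` amplification survives the closeness error with a factor 2. -/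
theorem well_inverse_eventually {C Q p m : ℝ} (hC : 0 ≤ C) (hpm : p < m) :
    ∀ᶠ n : ℕ in atTop, ∀ (G : Type u) [NormedAddCommGroup G] (S J₀ : G → G),
      (∀ y, ‖y‖ ≤ C * (n : ℝ) ^ p * ‖J₀ y‖) →
      (∀ y, ‖S y - J₀ y‖ ≤ Q * (n : ℝ) ^ (-m) * ‖y‖) →
      ∀ y, ‖y‖ ≤ 2 * (C * (n : ℝ) ^ p) * ‖S y‖ := by
  filter_upwards [midgap_closeness_eventually (C := C) (Q := Q) hpm] with n hn G _ S J₀ hJ hq y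
  have hb : 0 ≤ C * (n : ℝ) ^ p := mul_nonneg hC (Real.rpow_nonneg (Nat.cast_nonneg n) p)
  have hqb : Q * (n : ℝ) ^ (-m) * (C * (n : ℝ) ^ p) < 1 := by linarith
  have h0 := inverse_bound_of_close S J₀ hb hJ hq hqb y
  have hden : (1 : ℝ) / 2 ≤ 1 - Q * (n : ℝ) ^ (-m) * (C * (n : ℝ) ^ p) := by linarith
  have hfrac : C * (n : ℝ) ^ p / (1 - Q * (n : ℝ) ^ (-m) * (C * (n : ℝ) ^ p))
      ≤ 2 * (C * (n : ℝ) ^ p) := by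
    calc C * (n : ℝ) ^ p / (1 - Q * (n : ℝ) ^ (-m) * (C * (n : ℝ) ^ p))
        ≤ C * (n : ℝ) ^ p / (1 / 2) := div_le_div_of_nonneg_left hb (by norm_num) hden
      _ = 2 * (C * (n : ℝ) ^ p) := by ring
  calc ‖y‖ ≤ _ := h0
    _ ≤ 2 * (C * (n : ℝ) ^ p) * ‖S y‖ := by gcongr

end Summit.AnomalousDissipation.AnomalousDissipation.Theorems
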